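import Summits.QuantumFields.YangMills.Theorems.BalabanUVNodesN15TwoSpacingGluingNonlocal
import Summits.QuantumFields.YangMills.Theorems.BalabanUVNodesN15TwoSpacingGluingAdjoint
import HarnessLib

/-!
# THE GLUING STEP AT TWO LATTICE SPACINGS, XV: ONE-SIDED localized rows suffice for the remainders — INPUT-localized `1_{S_□}(y′)·θe^{−δd}` for `R = −Σ_□[Δ_a, M_{h_□}]G_□M_{h_□}`,
# OUTPUT-localized `1_{S_□}(y)·θe^{−δd}` for the adjoint `R̃` — which is what a NONLOCAL `Δ_a = Δ_loc + N` delivers: the local part's two-sided row (FILES 46∕52∕53) plus `[N, M_h]`'s global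
# letter (FILE 56) composed with the two-sided cube letter, at the cost of the row-sum rate `σ` (dag-n15-c g11, FILE 57; N15 = NE2, s1 «background-layer OPERATOR ingredient»; generic)

Cell `pub-ymgap`, seat `pub-ymgap-dag-n15-c` (R134 (a); HUMAN RULING D-0062), generation 11.  `bears_on: R4∕N15 · K3⁷ SpineGivenEndpointR13SepCoPH (stmt-QuantumFields-20544)`.
Filed `--supports stmt-QuantumFields-20544 --as helper` — COUNT-NEUTRAL.  Theorems only (0 `def`, 0 `sorry`).  Imports BY NAME FILE 56 `…N15TwoSpacingGluingNonlocal` (FILE 45 `remainder`,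
`hasMaj_fsum`, `hasMaj_comp_diag`, FILE 46 `commOp_add_left` via 49) and FILE 49 `…N15TwoSpacingGluingAdjoint` (`remainderL`); B11 `hasMaj_comp`, `conv_exp_le`, `RowSum`,
`Triangle254`; nothing in the tree is modified.

WHY.  FILE 45 `hasMaj_remainder` ∕ FILE 49 `hasMaj_remainderL` take TWO-SIDED localized commutator rows `1_S(y)1_S(y′)θ₀e^{−δd}` but USE only one indicator (the bounded-overlap sum
`Σ_□` needs one).  With Bałaban's nonlocal `Δ_a = Δ − ∂P∂* + aQ*Q` ([B5] (1.120)–(1.121) p.37) the row `[Δ_a, M_{h_□}]∘G_□` is localized only on the INPUT side (through `G_□`), and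
`G_□∘[Δ_a, M_{h_□}]` only on the OUTPUT side (dag-n15-a g19 l.27702).  THIS FILE: ★ `hasMaj_sum_overlap_in` (FILE 45's overlap summation with the indicator on the input variable);
★ `hasMaj_comp_exp_in` ∕ `hasMaj_comp_exp_out` (global-after-localized and localized-after-global compositions keep the outer indicator, B11's row-sum rate bookkeeping); ★★
`hasMaj_remainder_in` ∕ `hasMaj_idef_remainder_in` (FILE 45's two remainder letters from INPUT-localized rows — same constants `N_ovθ₀`, `N_ov(θ₀o + r)`); ★★ `hasMaj_remainderL_out` ∕
`hasMaj_idef_remainderL_out` (FILE 49's from OUTPUT-localized rows); ★★ `hasMaj_commOp_comp_of_add` — for `Δ = Δ_loc + N`: the two-sided local row `θ₁` (rate `δ`), the global nonlocal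
commutator letter `[N, M_h] ≤ c_K e^{−ρ₁d}` (FILE 56) and the cube letter `G ≤ 1_S1_Sβe^{−δd}` give the input-localized row `[Δ, M_h]∘G ≤ 1_S(y′)(θ₁ + c_Kβc_r)e^{−ρd}` (`ρ ≤ δ`,
`ρ + σ ≤ ρ₁`); ★★ `hasMaj_comp_commOp_of_add` — the adjoint twin, output-localized; ★★★ `hasMaj_idef_glued_of_cubes_in` — FILE 45's glued two-grid defect from cubes VERBATIM with
one-sided remainder rows.  So the Neumann resummation of FILES 43∕44 runs unchanged for a nonlocal `Δ_a`.

HONEST FRAMING ∕ LIMITS.  Block-majorant bookkeeping ([B6] (2.52)–(2.56) pp.232–233, (2.61) p.234, (2.91)–(2.92) p.239, (2.134)–(2.135) p.247; [B5] (1.120)–(1.128) pp.37–38 = SHAPES ∕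
MECHANISM; nothing asserted); every letter stays displayed.  NE2⁺ NOT PRINTED, NOT proved; N15 NOT discharged; counts of record UNMOVED (typed 28∕28 · discharged 5∕27); one finite 𝕋⁴
at fixed ε — NOT infinite volume, NOT OS on ℝ⁴, NOT a mass gap, NOT Clay; R4 closes the conditional finite-𝕋⁴ rung `BalabanLadder.UV` only.  Restate-immune (no Theses import).
-/

noncomputable section

namespace Summit.QuantumFields.YangMills.BalabanUVNodes.N15.Gluing

open Literature.MathematicalPhysics.QuantumFieldTheory.Balaban1983to89
open Literature.MathematicalPhysics.QuantumFieldTheory.Balaban1983to89.B11SectG (BlockNorm HasMaj RowSum hasMaj_comp conv_exp_le)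
open Literature.MathematicalPhysics.QuantumFieldTheory.Balaban1983to89.T4EtaRateDefect (idef idef_comp idef_add)
open Literature.MathematicalPhysics.QuantumFieldTheory.Balaban1983to89.T4EtaRateCoeffDefect (pull diagK hasMaj_mulOp hasMaj_idef_mulOp)
open Literature.MathematicalPhysics.QuantumFieldTheory.Balaban1983to89.B6RandomWalk (Triangle254)
open Literature.MathematicalPhysics.QuantumFieldTheory.Balaban1983to89.B6Prop26Gluing (mulOp ind ind_nonneg ind_le_one)

/-! ## §1 Input-side bounded overlap; localized compositions with rates -/

section Helpers

variable {g : B6.Geometry} {F₁ F₃ : Type} [AddCommGroup F₁] [Module ℝ F₁] [AddCommGroup F₃] [Module ℝ F₃] {b₁ : BlockNorm g F₁} {b₃ : BlockNorm g F₃}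
  {X₂ : Type} [Fintype X₂] (blk₂ : X₂ → g.Site)

/-- ★ **BOUNDED OVERLAP, INPUT SIDE**: if every term's majorant carries the indicator `1_{S_□}(y′)` of its cube's reach on the INPUT variable and each block meets at most `N_ov`
reaches, the sum has majorant `N_ov·K`. [cite: Balaban1984PropagatorsII, (2.134)–(2.135) p.247 (mechanism)] -/
theorem hasMaj_sum_overlap_in {ι : Type} [Fintype ι] (T : ι → F₁ →ₗ[ℝ] F₃) (S : ι → Set g.Site) (K : g.Site → g.Site → ℝ) (Nov : ℝ) (hK : ∀ a b, 0 ≤ K a b)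
    (h : ∀ i, HasMaj b₁ b₃ (T i) (fun a b => ind (S i) b * K a b)) (hN : ∀ b, ∑ i, ind (S i) b ≤ Nov) :
    HasMaj b₁ b₃ (∑ i, T i) (fun a b => Nov * K a b) := by
  refine (hasMaj_fsum Finset.univ T _ fun i _ => h i).mono fun a b => ?_
  rw [← Finset.sum_mul]
  exact mul_le_mul_of_nonneg_right (hN b) (hK a b)

/-- ★ **GLOBAL AFTER TWO-SIDED LOCALIZED keeps the input indicator**: `T₁ ≤ a₁e^{−ρ₁d}`, `T₂ ≤ 1_S1_S·a₂e^{−ρ₂d}`, `ρ ≤ ρ₂`, `ρ + σ ≤ ρ₁`, row sum `(σ, c)` ⟹ `T₁∘T₂ ≤ 1_S(y′)·a₁a₂c·e^{−ρd}`.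
[cite: Balaban1984PropagatorsII, (2.52)–(2.56) pp.232–233 (mechanism)] -/
theorem hasMaj_comp_exp_in {T₁ : (X₂ → ℝ) →ₗ[ℝ] F₃} {T₂ : F₁ →ₗ[ℝ] (X₂ → ℝ)} {S : Set g.Site} {a₁ a₂ ρ₁ ρ₂ ρ σ c : ℝ} (htri : Triangle254 g) (hd : ∀ a b : g.Site, 0 ≤ g.dist a b)
    (hrow : RowSum g σ c) (ha₁ : 0 ≤ a₁) (ha₂ : 0 ≤ a₂) (hρ : 0 ≤ ρ) (hρ₂ : ρ ≤ ρ₂) (hρ₁ : ρ + σ ≤ ρ₁)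
    (h₁ : HasMaj (BlockNorm.ofBlocks g blk₂) b₃ T₁ (fun a b => a₁ * Real.exp (-(ρ₁ * g.dist a b))))
    (h₂ : HasMaj b₁ (BlockNorm.ofBlocks g blk₂) T₂ (fun a b => ind S a * ind S b * (a₂ * Real.exp (-(ρ₂ * g.dist a b))))) :
    HasMaj b₁ b₃ (T₁ ∘ₗ T₂) (fun a b => ind S b * (a₁ * a₂ * c * Real.exp (-(ρ * g.dist a b)))) := by
  refine (hasMaj_comp h₁ h₂ fun a b => mul_nonneg ha₁ (Real.exp_nonneg _)).mono fun a b => ?_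
  have hconv := conv_exp_le htri hd hrow hρ hρ₂ hρ₁ a b
  rw [show (BlockNorm.ofBlocks g blk₂).κ = 1 from rfl]
  calc ∑ y'' : g.Site, a₁ * Real.exp (-(ρ₁ * g.dist a y'')) * (1 * (ind S y'' * ind S b * (a₂ * Real.exp (-(ρ₂ * g.dist y'' b)))))
      ≤ ∑ y'' : g.Site, ind S b * (a₁ * a₂) * (Real.exp (-(ρ₁ * g.dist a y'')) * Real.exp (-(ρ₂ * g.dist y'' b))) :=
        Finset.sum_le_sum fun y'' _ => by
          have h1 := ind_le_one S y''
          have h0 : 0 ≤ ind S b * (a₁ * a₂) * (Real.exp (-(ρ₁ * g.dist a y'')) * Real.exp (-(ρ₂ * g.dist y'' b))) :=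
            mul_nonneg (mul_nonneg (ind_nonneg _ _) (mul_nonneg ha₁ ha₂)) (mul_nonneg (Real.exp_nonneg _) (Real.exp_nonneg _))
          calc a₁ * Real.exp (-(ρ₁ * g.dist a y'')) * (1 * (ind S y'' * ind S b * (a₂ * Real.exp (-(ρ₂ * g.dist y'' b)))))
              = ind S y'' * (ind S b * (a₁ * a₂) * (Real.exp (-(ρ₁ * g.dist a y'')) * Real.exp (-(ρ₂ * g.dist y'' b)))) := by ring
            _ ≤ 1 * (ind S b * (a₁ * a₂) * (Real.exp (-(ρ₁ * g.dist a y'')) * Real.exp (-(ρ₂ * g.dist y'' b)))) := mul_le_mul_of_nonneg_right h1 h0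
            _ = _ := one_mul _
    _ = ind S b * (a₁ * a₂) * ∑ y'' : g.Site, Real.exp (-(ρ₁ * g.dist a y'')) * Real.exp (-(ρ₂ * g.dist y'' b)) := by rw [Finset.mul_sum]
    _ ≤ ind S b * (a₁ * a₂) * (c * Real.exp (-(ρ * g.dist a b))) := mul_le_mul_of_nonneg_left hconv (mul_nonneg (ind_nonneg _ _) (mul_nonneg ha₁ ha₂))
    _ = _ := by ring

/-- ★ **TWO-SIDED LOCALIZED AFTER GLOBAL keeps the output indicator**: `T₁ ≤ 1_S1_S·a₁e^{−ρ₁d}`, `T₂ ≤ a₂e^{−ρ₂d}` ⟹ `T₁∘T₂ ≤ 1_S(y)·a₁a₂c·e^{−ρd}`.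
[cite: Balaban1984PropagatorsII, (2.52)–(2.56) pp.232–233 (mechanism)] -/
theorem hasMaj_comp_exp_out {T₁ : (X₂ → ℝ) →ₗ[ℝ] F₃} {T₂ : F₁ →ₗ[ℝ] (X₂ → ℝ)} {S : Set g.Site} {a₁ a₂ ρ₁ ρ₂ ρ σ c : ℝ} (htri : Triangle254 g) (hd : ∀ a b : g.Site, 0 ≤ g.dist a b)
    (hrow : RowSum g σ c) (ha₁ : 0 ≤ a₁) (ha₂ : 0 ≤ a₂) (hρ : 0 ≤ ρ) (hρ₂ : ρ ≤ ρ₂) (hρ₁ : ρ + σ ≤ ρ₁)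
    (h₁ : HasMaj (BlockNorm.ofBlocks g blk₂) b₃ T₁ (fun a b => ind S a * ind S b * (a₁ * Real.exp (-(ρ₁ * g.dist a b)))))
    (h₂ : HasMaj b₁ (BlockNorm.ofBlocks g blk₂) T₂ (fun a b => a₂ * Real.exp (-(ρ₂ * g.dist a b)))) :
    HasMaj b₁ b₃ (T₁ ∘ₗ T₂) (fun a b => ind S a * (a₁ * a₂ * c * Real.exp (-(ρ * g.dist a b)))) := by
  refine (hasMaj_comp h₁ h₂ fun a b => mul_nonneg (mul_nonneg (ind_nonneg _ _) (ind_nonneg _ _)) (mul_nonneg ha₁ (Real.exp_nonneg _))).mono fun a b => ?_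
  have hconv := conv_exp_le htri hd hrow hρ hρ₂ hρ₁ a b
  rw [show (BlockNorm.ofBlocks g blk₂).κ = 1 from rfl]
  calc ∑ y'' : g.Site, ind S a * ind S y'' * (a₁ * Real.exp (-(ρ₁ * g.dist a y''))) * (1 * (a₂ * Real.exp (-(ρ₂ * g.dist y'' b))))
      ≤ ∑ y'' : g.Site, ind S a * (a₁ * a₂) * (Real.exp (-(ρ₁ * g.dist a y'')) * Real.exp (-(ρ₂ * g.dist y'' b))) :=
        Finset.sum_le_sum fun y'' _ => by
          have h1 := ind_le_one S y''
          have h0 : 0 ≤ ind S a * (a₁ * a₂) * (Real.exp (-(ρ₁ * g.dist a y'')) * Real.exp (-(ρ₂ * g.dist y'' b))) :=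
            mul_nonneg (mul_nonneg (ind_nonneg _ _) (mul_nonneg ha₁ ha₂)) (mul_nonneg (Real.exp_nonneg _) (Real.exp_nonneg _))
          calc ind S a * ind S y'' * (a₁ * Real.exp (-(ρ₁ * g.dist a y''))) * (1 * (a₂ * Real.exp (-(ρ₂ * g.dist y'' b))))
              = ind S y'' * (ind S a * (a₁ * a₂) * (Real.exp (-(ρ₁ * g.dist a y'')) * Real.exp (-(ρ₂ * g.dist y'' b)))) := by ring
            _ ≤ 1 * (ind S a * (a₁ * a₂) * (Real.exp (-(ρ₁ * g.dist a y'')) * Real.exp (-(ρ₂ * g.dist y'' b)))) := mul_le_mul_of_nonneg_right h1 h0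
            _ = _ := one_mul _
    _ = ind S a * (a₁ * a₂) * ∑ y'' : g.Site, Real.exp (-(ρ₁ * g.dist a y'')) * Real.exp (-(ρ₂ * g.dist y'' b)) := by rw [Finset.mul_sum]
    _ ≤ ind S a * (a₁ * a₂) * (c * Real.exp (-(ρ * g.dist a b))) := mul_le_mul_of_nonneg_left hconv (mul_nonneg (ind_nonneg _ _) (mul_nonneg ha₁ ha₂))
    _ = _ := by ring

end Helpers

/-! ## §2 The remainders from one-sided rows -/

section Remainders

variable {X X' : Type} [Fintype X] [Fintype X'] {K : Type} [Fintype K] {g : B6.Geometry} (blk : X → g.Site) (π : X' → X) (S : K → Set g.Site)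

/-- ★★ **THE REMAINDER IS SMALL AND DECAYS, from INPUT-localized rows** `[Δ_a, M_{h_□}]∘G_□ ≤ 1_{S_□}(y′)·θ₀e^{−δd}`, `|h_□| ≤ 1`, input overlap `≤ N_ov` ⟹ `R ≤ N_ovθ₀·e^{−δd}` — FILE 45
`hasMaj_remainder` for a nonlocal `Δ_a`. [cite: Balaban1984PropagatorsII, (2.134)–(2.135) p.247 (shapes + mechanism); Balaban1984PropagatorsI, (1.121)–(1.123) p.37] -/
theorem hasMaj_remainder_in {Δ : (X → ℝ) →ₗ[ℝ] (X → ℝ)} {h : K → X → ℝ} {G : K → (X → ℝ) →ₗ[ℝ] (X → ℝ)} {θ₀ δ Nov : ℝ} (hθ : 0 ≤ θ₀) (hh : ∀ i x, |h i x| ≤ 1)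
    (hN : ∀ b, ∑ i, ind (S i) b ≤ Nov)
    (hKc : ∀ i, HasMaj (BlockNorm.ofBlocks g blk) (BlockNorm.ofBlocks g blk) (commOp Δ (h i) ∘ₗ G i) (fun y y' => ind (S i) y' * (θ₀ * Real.exp (-(δ * g.dist y y'))))) :
    HasMaj (BlockNorm.ofBlocks g blk) (BlockNorm.ofBlocks g blk) (remainder Δ h G) (fun y y' => Nov * θ₀ * Real.exp (-(δ * g.dist y y'))) := by
  have hterm : ∀ i, HasMaj (BlockNorm.ofBlocks g blk) (BlockNorm.ofBlocks g blk) ((commOp Δ (h i) ∘ₗ G i) ∘ₗ mulOp (h i))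
      (fun y y' => ind (S i) y' * (θ₀ * Real.exp (-(δ * g.dist y y')))) := fun i => by
    have hMb := hasMaj_mulOp (g := g) blk (m := fun _ => (1 : ℝ)) (fun _ => zero_le_one) (hh i)
    refine (hasMaj_comp_diag blk (fun y y' => mul_nonneg (ind_nonneg _ _) (mul_nonneg hθ (Real.exp_nonneg _))) (hKc i) hMb).mono fun y y' => le_of_eq ?_
    ring
  have hsum := hasMaj_sum_overlap_in _ S _ Nov (fun y y' => mul_nonneg hθ (Real.exp_nonneg _)) hterm hN
  rw [remainder]
  refine (hsum.neg.congr fun μ => ?_).mono fun y y' => le_of_eq (by ring)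
  simp only [LinearMap.neg_apply, LinearMap.coe_sum, Finset.sum_apply, LinearMap.comp_apply]

/-- ★★ **ITS η-DEFECT from input-localized rows**: fine rows `θ₀`, row defects `𝔇([Δ′,M_{h′}]G′, [Δ,M_h]G) ≤ 1_{S_□}(y′)·re^{−δd}`, coarse `|h| ≤ 1`, fit `o`, input overlap `≤ N_ov` ⟹
`𝔇(R′, R) ≤ N_ov(θ₀o + r)·e^{−δd}` — FILE 45 `hasMaj_idef_remainder` for a nonlocal `Δ_a`. [cite: Balaban1984PropagatorsII, (2.134)–(2.135) p.247 (shapes); Balaban1985BackgroundPropagators, Thm 3.14 pp.426–427 (template)] -/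
theorem hasMaj_idef_remainder_in {Δ : (X → ℝ) →ₗ[ℝ] (X → ℝ)} {Δ' : (X' → ℝ) →ₗ[ℝ] (X' → ℝ)} {h : K → X → ℝ} {h' : K → X' → ℝ} {G : K → (X → ℝ) →ₗ[ℝ] (X → ℝ)}
    {G' : K → (X' → ℝ) →ₗ[ℝ] (X' → ℝ)} {θ₀ r o δ Nov : ℝ} (hθ : 0 ≤ θ₀) (hr : 0 ≤ r) (ho : 0 ≤ o) (hh : ∀ i x, |h i x| ≤ 1) (hfit : ∀ i x', |h' i x' - h i (π x')| ≤ o)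
    (hN : ∀ b, ∑ i, ind (S i) b ≤ Nov)
    (hK' : ∀ i, HasMaj (BlockNorm.ofBlocks g (blk ∘ π)) (BlockNorm.ofBlocks g (blk ∘ π)) (commOp Δ' (h' i) ∘ₗ G' i)
      (fun y y' => ind (S i) y' * (θ₀ * Real.exp (-(δ * g.dist y y')))))
    (hDK : ∀ i, HasMaj (BlockNorm.ofBlocks g blk) (BlockNorm.ofBlocks g (blk ∘ π)) (idef (pull π) (pull π) (commOp Δ' (h' i) ∘ₗ G' i) (commOp Δ (h i) ∘ₗ G i))
      (fun y y' => ind (S i) y' * (r * Real.exp (-(δ * g.dist y y'))))) :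
    HasMaj (BlockNorm.ofBlocks g blk) (BlockNorm.ofBlocks g (blk ∘ π)) (idef (pull π) (pull π) (remainder Δ' h' G') (remainder Δ h G))
      (fun y y' => Nov * (θ₀ * o + r) * Real.exp (-(δ * g.dist y y'))) := by
  have hE : ∀ y y' : g.Site, 0 ≤ Real.exp (-(δ * g.dist y y')) := fun _ _ => Real.exp_nonneg _
  have hterm : ∀ i, HasMaj (BlockNorm.ofBlocks g blk) (BlockNorm.ofBlocks g (blk ∘ π))
      (idef (pull π) (pull π) ((commOp Δ' (h' i) ∘ₗ G' i) ∘ₗ mulOp (h' i)) ((commOp Δ (h i) ∘ₗ G i) ∘ₗ mulOp (h i)))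
      (fun y y' => ind (S i) y' * ((θ₀ * o + r) * Real.exp (-(δ * g.dist y y')))) := fun i => by
    have hMa := hasMaj_mulOp (g := g) blk (m := fun _ => (1 : ℝ)) (fun _ => zero_le_one) (hh i)
    have hDM := hasMaj_idef_mulOp (g := g) blk π (o := fun _ => o) (fun _ => ho) (fun x' => hfit i x')
    have hnn : ∀ (c : ℝ), 0 ≤ c → ∀ y y' : g.Site, 0 ≤ ind (S i) y' * (c * Real.exp (-(δ * g.dist y y'))) :=
      fun c hc y y' => mul_nonneg (ind_nonneg _ _) (mul_nonneg hc (hE y y'))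
    have t1 := hasMaj_comp_diag (blk ∘ π) (hnn θ₀ hθ) (hK' i) hDM
    have t2 := hasMaj_comp_diag blk (hnn r hr) (hDK i) hMa
    rw [idef_comp (pull π) (pull π) (pull π)]
    refine (t1.add t2).mono fun y y' => le_of_eq ?_
    ring
  rw [remainder, remainder, idef_neg, idef_fsum]
  refine ((hasMaj_sum_overlap_in _ S _ Nov (fun y y' => mul_nonneg (by positivity) (hE y y')) hterm hN).neg).mono fun y y' => le_of_eq ?_
  ring

/-- ★★ **THE ADJOINT REMAINDER from OUTPUT-localized rows** `G_□∘[Δ_a, M_{h_□}] ≤ 1_{S_□}(y)·θ₀e^{−δd}`, `|h_□| ≤ 1`, output overlap `≤ N_ov` ⟹ `R̃ ≤ N_ovθ₀·e^{−δd}` — FILE 49 `hasMaj_remainderL`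
for a nonlocal `Δ_a`. [cite: Balaban1984PropagatorsII, (2.134)–(2.135) p.247 (shapes, transposed); Balaban1984PropagatorsI, p.39 («a representation of G adjoint to (1.123)»)] -/
theorem hasMaj_remainderL_out {Δ : (X → ℝ) →ₗ[ℝ] (X → ℝ)} {h : K → X → ℝ} {G : K → (X → ℝ) →ₗ[ℝ] (X → ℝ)} {θ₀ δ Nov : ℝ} (hθ : 0 ≤ θ₀) (hh : ∀ i x, |h i x| ≤ 1)
    (hN : ∀ a, ∑ i, ind (S i) a ≤ Nov)
    (hKc : ∀ i, HasMaj (BlockNorm.ofBlocks g blk) (BlockNorm.ofBlocks g blk) (G i ∘ₗ commOp Δ (h i)) (fun y y' => ind (S i) y * (θ₀ * Real.exp (-(δ * g.dist y y'))))) :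
    HasMaj (BlockNorm.ofBlocks g blk) (BlockNorm.ofBlocks g blk) (remainderL Δ h G) (fun y y' => Nov * θ₀ * Real.exp (-(δ * g.dist y y'))) := by
  have hterm : ∀ i, HasMaj (BlockNorm.ofBlocks g blk) (BlockNorm.ofBlocks g blk) (mulOp (h i) ∘ₗ (G i ∘ₗ commOp Δ (h i)))
      (fun y y' => ind (S i) y * (θ₀ * Real.exp (-(δ * g.dist y y')))) := fun i => by
    have hMa := hasMaj_mulOp (g := g) blk (m := fun _ => (1 : ℝ)) (fun _ => zero_le_one) (hh i)
    refine (hasMaj_diag_comp blk (fun _ => zero_le_one) hMa (hKc i)).mono fun y y' => le_of_eq ?_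
    ring
  have hsum := hasMaj_sum_overlap _ S _ Nov (fun y y' => mul_nonneg hθ (Real.exp_nonneg _)) hterm hN
  rw [remainderL]
  refine (hsum.congr fun μ => ?_).mono fun y y' => le_of_eq (by ring)
  simp only [LinearMap.coe_sum, Finset.sum_apply, LinearMap.comp_apply]

/-- ★★ **ITS η-DEFECT from output-localized rows**: `𝔇(R̃′, R̃) ≤ N_ov(r + oθ₀)·e^{−δd}` from coarse rows `θ₀`, row defects `r` (both `1_{S_□}(y)`-localized), the fine `|h′| ≤ 1`, the fit `o`.
[cite: Balaban1984PropagatorsII, (2.134)–(2.135) p.247 (shapes, transposed); Balaban1985BackgroundPropagators, Thm 3.14 pp.426–427 (template)] -/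
theorem hasMaj_idef_remainderL_out {Δ : (X → ℝ) →ₗ[ℝ] (X → ℝ)} {Δ' : (X' → ℝ) →ₗ[ℝ] (X' → ℝ)} {h : K → X → ℝ} {h' : K → X' → ℝ} {G : K → (X → ℝ) →ₗ[ℝ] (X → ℝ)}
    {G' : K → (X' → ℝ) →ₗ[ℝ] (X' → ℝ)} {θ₀ r o δ Nov : ℝ} (hθ : 0 ≤ θ₀) (hr : 0 ≤ r) (ho : 0 ≤ o) (hh' : ∀ i x', |h' i x'| ≤ 1) (hfit : ∀ i x', |h' i x' - h i (π x')| ≤ o)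
    (hN : ∀ a, ∑ i, ind (S i) a ≤ Nov)
    (hKc : ∀ i, HasMaj (BlockNorm.ofBlocks g blk) (BlockNorm.ofBlocks g blk) (G i ∘ₗ commOp Δ (h i)) (fun y y' => ind (S i) y * (θ₀ * Real.exp (-(δ * g.dist y y')))))
    (hDK : ∀ i, HasMaj (BlockNorm.ofBlocks g blk) (BlockNorm.ofBlocks g (blk ∘ π)) (idef (pull π) (pull π) (G' i ∘ₗ commOp Δ' (h' i)) (G i ∘ₗ commOp Δ (h i)))
      (fun y y' => ind (S i) y * (r * Real.exp (-(δ * g.dist y y'))))) :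
    HasMaj (BlockNorm.ofBlocks g blk) (BlockNorm.ofBlocks g (blk ∘ π)) (idef (pull π) (pull π) (remainderL Δ' h' G') (remainderL Δ h G))
      (fun y y' => Nov * (r + o * θ₀) * Real.exp (-(δ * g.dist y y'))) := by
  have hterm : ∀ i, HasMaj (BlockNorm.ofBlocks g blk) (BlockNorm.ofBlocks g (blk ∘ π))
      (idef (pull π) (pull π) (mulOp (h' i) ∘ₗ (G' i ∘ₗ commOp Δ' (h' i))) (mulOp (h i) ∘ₗ (G i ∘ₗ commOp Δ (h i))))
      (fun y y' => ind (S i) y * ((r + o * θ₀) * Real.exp (-(δ * g.dist y y')))) := fun i => by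
    have hMa' := hasMaj_mulOp (g := g) (blk ∘ π) (m := fun _ => (1 : ℝ)) (fun _ => zero_le_one) (hh' i)
    have hDM := hasMaj_idef_mulOp (g := g) blk π (o := fun _ => o) (fun _ => ho) (fun x' => hfit i x')
    have t1 := hasMaj_diag_comp (blk ∘ π) (fun _ => zero_le_one) hMa' (hDK i)
    have t2 := hasMaj_diag_comp blk (fun _ => ho) hDM (hKc i)
    rw [idef_comp (pull π) (pull π) (pull π)]
    refine (t1.add t2).mono fun y y' => le_of_eq ?_
    ring
  rw [remainderL, remainderL, idef_fsum]
  refine (hasMaj_sum_overlap _ S _ Nov (fun y y' => mul_nonneg (by positivity) (Real.exp_nonneg _)) hterm hN).mono fun y y' => le_of_eq ?_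
  ring

end Remainders

/-! ## §3 The rows of a local-plus-nonlocal `Δ_a = Δ_loc + N` -/

section Rows

variable {X : Type} [Fintype X] {g : B6.Geometry} (blk : X → g.Site) {σ cr : ℝ}

/-- ★★ **THE LEFT ROW OF `Δ_loc + N`**: two-sided local row `[Δ_loc, M_h]∘G ≤ 1_S1_S·θ₁e^{−δd}` (FILES 46∕52), the global nonlocal commutator letter `[N, M_h] ≤ c_K·e^{−ρ₁d}` (FILE 56), the
cube letter `G ≤ 1_S1_S·βe^{−δd}`, `0 ≤ ρ ≤ δ`, `ρ + σ ≤ ρ₁`, row sum `(σ, c_r)` ⟹ `[Δ_loc + N, M_h]∘G ≤ 1_S(y′)·(θ₁ + c_Kβc_r)·e^{−ρd}` — input-localized, as `hasMaj_remainder_in` wants.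
[cite: Balaban1984PropagatorsI, (1.121) p.37, (1.128) p.38 (mechanism); Balaban1984PropagatorsII, (2.134) p.247 (shape)] -/
theorem hasMaj_commOp_comp_of_add (htri : Triangle254 g) (hd : ∀ a b : g.Site, 0 ≤ g.dist a b) (hrow : RowSum g σ cr) {Δloc N G : (X → ℝ) →ₗ[ℝ] (X → ℝ)} {h : X → ℝ}
    {S : Set g.Site} {θ₁ cK β δ ρ ρ₁ : ℝ} (hθ₁ : 0 ≤ θ₁) (hcK : 0 ≤ cK) (hβ : 0 ≤ β) (hρ : 0 ≤ ρ) (hρδ : ρ ≤ δ) (hρ₁ : ρ + σ ≤ ρ₁)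
    (hKloc : HasMaj (BlockNorm.ofBlocks g blk) (BlockNorm.ofBlocks g blk) (commOp Δloc h ∘ₗ G) (fun y y' => ind S y * ind S y' * (θ₁ * Real.exp (-(δ * g.dist y y')))))
    (hKN : HasMaj (BlockNorm.ofBlocks g blk) (BlockNorm.ofBlocks g blk) (commOp N h) (fun y y' => cK * Real.exp (-(ρ₁ * g.dist y y'))))
    (hG : HasMaj (BlockNorm.ofBlocks g blk) (BlockNorm.ofBlocks g blk) G (fun y y' => ind S y * ind S y' * (β * Real.exp (-(δ * g.dist y y'))))) :
    HasMaj (BlockNorm.ofBlocks g blk) (BlockNorm.ofBlocks g blk) (commOp (Δloc + N) h ∘ₗ G) (fun y y' => ind S y' * ((θ₁ + cK * β * cr) * Real.exp (-(ρ * g.dist y y')))) := by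
  have t2 := hasMaj_comp_exp_in blk htri hd hrow hcK hβ hρ hρδ hρ₁ hKN hG
  rw [commOp_add_left, LinearMap.add_comp]
  refine (hKloc.add t2).mono fun y y' => ?_
  have hexp : Real.exp (-(δ * g.dist y y')) ≤ Real.exp (-(ρ * g.dist y y')) := Real.exp_le_exp.2 (by nlinarith [hd y y'])
  have h1 : ind S y * ind S y' * (θ₁ * Real.exp (-(δ * g.dist y y'))) ≤ ind S y' * (θ₁ * Real.exp (-(ρ * g.dist y y'))) := by
    have hy := ind_le_one S y
    have h0 : 0 ≤ ind S y' * (θ₁ * Real.exp (-(ρ * g.dist y y'))) := mul_nonneg (ind_nonneg _ _) (mul_nonneg hθ₁ (Real.exp_nonneg _))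
    calc ind S y * ind S y' * (θ₁ * Real.exp (-(δ * g.dist y y'))) ≤ ind S y * ind S y' * (θ₁ * Real.exp (-(ρ * g.dist y y'))) :=
          mul_le_mul_of_nonneg_left (mul_le_mul_of_nonneg_left hexp hθ₁) (mul_nonneg (ind_nonneg _ _) (ind_nonneg _ _))
      _ = ind S y * (ind S y' * (θ₁ * Real.exp (-(ρ * g.dist y y')))) := by ring
      _ ≤ 1 * (ind S y' * (θ₁ * Real.exp (-(ρ * g.dist y y')))) := mul_le_mul_of_nonneg_right hy h0
      _ = _ := one_mul _
  calc ind S y * ind S y' * (θ₁ * Real.exp (-(δ * g.dist y y'))) + ind S y' * (cK * β * cr * Real.exp (-(ρ * g.dist y y')))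
      ≤ ind S y' * (θ₁ * Real.exp (-(ρ * g.dist y y'))) + ind S y' * (cK * β * cr * Real.exp (-(ρ * g.dist y y'))) := by linarith
    _ = _ := by ring

/-- ★★ **THE ADJOINT ROW OF `Δ_loc + N`**: `G∘[Δ_loc, M_h] ≤ 1_S1_S·θ₁e^{−δd}` (FILES 49∕53), `[N, M_h] ≤ c_K·e^{−ρ₁d}`, `G ≤ 1_S1_S·βe^{−δd}` ⟹ `G∘[Δ_loc + N, M_h] ≤ 1_S(y)·(θ₁ + βc_Kc_r)·e^{−ρd}`
(`0 ≤ ρ ≤ ρ₁`, `ρ + σ ≤ δ`, `σ ≥ 0`) — output-localized, as `hasMaj_remainderL_out` wants. [cite: Balaban1984PropagatorsI, p.39 (adjoint representation); Balaban1984PropagatorsII, (2.134) p.247 (shape)] -/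
theorem hasMaj_comp_commOp_of_add (htri : Triangle254 g) (hd : ∀ a b : g.Site, 0 ≤ g.dist a b) (hrow : RowSum g σ cr) (hσ : 0 ≤ σ) {Δloc N G : (X → ℝ) →ₗ[ℝ] (X → ℝ)}
    {h : X → ℝ} {S : Set g.Site} {θ₁ cK β δ ρ ρ₁ : ℝ} (hθ₁ : 0 ≤ θ₁) (hcK : 0 ≤ cK) (hβ : 0 ≤ β) (hρ : 0 ≤ ρ) (hρ₁ : ρ ≤ ρ₁) (hρδ : ρ + σ ≤ δ)
    (hKloc : HasMaj (BlockNorm.ofBlocks g blk) (BlockNorm.ofBlocks g blk) (G ∘ₗ commOp Δloc h) (fun y y' => ind S y * ind S y' * (θ₁ * Real.exp (-(δ * g.dist y y')))))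
    (hKN : HasMaj (BlockNorm.ofBlocks g blk) (BlockNorm.ofBlocks g blk) (commOp N h) (fun y y' => cK * Real.exp (-(ρ₁ * g.dist y y'))))
    (hG : HasMaj (BlockNorm.ofBlocks g blk) (BlockNorm.ofBlocks g blk) G (fun y y' => ind S y * ind S y' * (β * Real.exp (-(δ * g.dist y y'))))) :
    HasMaj (BlockNorm.ofBlocks g blk) (BlockNorm.ofBlocks g blk) (G ∘ₗ commOp (Δloc + N) h) (fun y y' => ind S y * ((θ₁ + β * cK * cr) * Real.exp (-(ρ * g.dist y y')))) := by
  have t2 := hasMaj_comp_exp_out blk htri hd hrow hβ hcK hρ hρ₁ hρδ hG hKN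
  rw [commOp_add_left, LinearMap.comp_add]
  refine (hKloc.add t2).mono fun y y' => ?_
  have hρδ' : ρ ≤ δ := by linarith
  have hexp : Real.exp (-(δ * g.dist y y')) ≤ Real.exp (-(ρ * g.dist y y')) := Real.exp_le_exp.2 (by nlinarith [hd y y'])
  have h1 : ind S y * ind S y' * (θ₁ * Real.exp (-(δ * g.dist y y'))) ≤ ind S y * (θ₁ * Real.exp (-(ρ * g.dist y y'))) := by
    have hy := ind_le_one S y'
    have h0 : 0 ≤ ind S y * (θ₁ * Real.exp (-(ρ * g.dist y y'))) := mul_nonneg (ind_nonneg _ _) (mul_nonneg hθ₁ (Real.exp_nonneg _))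
    calc ind S y * ind S y' * (θ₁ * Real.exp (-(δ * g.dist y y'))) ≤ ind S y * ind S y' * (θ₁ * Real.exp (-(ρ * g.dist y y'))) :=
          mul_le_mul_of_nonneg_left (mul_le_mul_of_nonneg_left hexp hθ₁) (mul_nonneg (ind_nonneg _ _) (ind_nonneg _ _))
      _ = ind S y' * (ind S y * (θ₁ * Real.exp (-(ρ * g.dist y y')))) := by ring
      _ ≤ 1 * (ind S y * (θ₁ * Real.exp (-(ρ * g.dist y y')))) := mul_le_mul_of_nonneg_right hy h0
      _ = _ := one_mul _
  calc ind S y * ind S y' * (θ₁ * Real.exp (-(δ * g.dist y y'))) + ind S y * (β * cK * cr * Real.exp (-(ρ * g.dist y y')))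
      ≤ ind S y * (θ₁ * Real.exp (-(ρ * g.dist y y'))) + ind S y * (β * cK * cr * Real.exp (-(ρ * g.dist y y'))) := by linarith
    _ = _ := by ring

end Rows

/-! ## §4 The glued two-grid defect from cubes with one-sided remainder rows -/

section Glued

variable {X X' : Type} [Fintype X] [Fintype X'] [DecidableEq X] [DecidableEq X'] {ι : Type} [Fintype ι] {g : B6.Geometry} (blk : X → g.Site) (π : X' → X)
  (S : ι → Set g.Site) {σ cr : ℝ}

/-- ★★★ **THE η-DEFECT OF THE GLUED PROPAGATOR FROM CUBES — ONE-SIDED (INPUT-localized) commutator rows.**  FILE 45 `hasMaj_idef_glued_of_cubes` verbatim, except that the remainder's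
rows `hK`, `hK′`, `hDK` carry only the INPUT indicator `1_{S_□}(y′)` — what a NONLOCAL `Δ_a = Δ_loc + N` delivers (★★ `hasMaj_commOp_comp_of_add`).  Same constants, same smallness
`N_ov·θ₀·c_r < 1`. [cite: Balaban1984PropagatorsII, (2.36) p.229, (2.91)–(2.92) p.239, (2.133)–(2.136) p.247 (mechanism); Balaban1984PropagatorsI, (1.121)–(1.123) p.37, (1.128) p.38] -/
theorem hasMaj_idef_glued_of_cubes_in (htri : Triangle254 g) (hd : ∀ a b : g.Site, 0 ≤ g.dist a b) (hd0 : ∀ y : g.Site, g.dist y y = 0) (hrow : RowSum g σ cr) (hσ : 0 ≤ σ)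
    (hcr : 0 ≤ cr) {Δ : (X → ℝ) →ₗ[ℝ] (X → ℝ)} {Δ' : (X' → ℝ) →ₗ[ℝ] (X' → ℝ)} {h : ι → X → ℝ} {h' : ι → X' → ℝ} {G : ι → (X → ℝ) →ₗ[ℝ] (X → ℝ)}
    {G' : ι → (X' → ℝ) →ₗ[ℝ] (X' → ℝ)} {β θ₀ m r o δ Nov : ℝ} (hβ : 0 ≤ β) (hθ : 0 ≤ θ₀) (hm : 0 ≤ m) (hr : 0 ≤ r) (ho : 0 ≤ o) (hNov : 0 ≤ Nov) (hσδ : 2 * σ ≤ δ)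
    (hh : ∀ i x, |h i x| ≤ 1) (hh' : ∀ i x', |h' i x'| ≤ 1) (hfit : ∀ i x', |h' i x' - h i (π x')| ≤ o) (hN : ∀ b, ∑ i, ind (S i) b ≤ Nov)
    (hG : ∀ i, HasMaj (BlockNorm.ofBlocks g blk) (BlockNorm.ofBlocks g blk) (G i) (fun y y' => ind (S i) y * ind (S i) y' * (β * Real.exp (-(δ * g.dist y y')))))
    (hG' : ∀ i, HasMaj (BlockNorm.ofBlocks g (blk ∘ π)) (BlockNorm.ofBlocks g (blk ∘ π)) (G' i)
      (fun y y' => ind (S i) y * ind (S i) y' * (β * Real.exp (-(δ * g.dist y y')))))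
    (hK : ∀ i, HasMaj (BlockNorm.ofBlocks g blk) (BlockNorm.ofBlocks g blk) (commOp Δ (h i) ∘ₗ G i)
      (fun y y' => ind (S i) y' * (θ₀ * Real.exp (-(δ * g.dist y y')))))
    (hK' : ∀ i, HasMaj (BlockNorm.ofBlocks g (blk ∘ π)) (BlockNorm.ofBlocks g (blk ∘ π)) (commOp Δ' (h' i) ∘ₗ G' i)
      (fun y y' => ind (S i) y' * (θ₀ * Real.exp (-(δ * g.dist y y')))))
    (hDG : ∀ i, HasMaj (BlockNorm.ofBlocks g blk) (BlockNorm.ofBlocks g (blk ∘ π)) (idef (pull π) (pull π) (G' i) (G i))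
      (fun y y' => ind (S i) y * ind (S i) y' * (m * Real.exp (-(δ * g.dist y y')))))
    (hDK : ∀ i, HasMaj (BlockNorm.ofBlocks g blk) (BlockNorm.ofBlocks g (blk ∘ π)) (idef (pull π) (pull π) (commOp Δ' (h' i) ∘ₗ G' i) (commOp Δ (h i) ∘ₗ G i))
      (fun y y' => ind (S i) y' * (r * Real.exp (-(δ * g.dist y y')))))
    (hq : Nov * θ₀ * cr < 1) :
    HasMaj (BlockNorm.ofBlocks g blk) (BlockNorm.ofBlocks g (blk ∘ π))
      (idef (pull π) (pull π) (glueInv (parametrix h' G') (remainder Δ' h' G')) (glueInv (parametrix h G) (remainder Δ h G)))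
      (fun y y' => (Nov * β * ((1 - Nov * θ₀ * cr)⁻¹ * ((1 - Nov * θ₀ * cr)⁻¹ * (Nov * (θ₀ * o + r)) * cr) * cr) * cr +
        Nov * (2 * β * o + m) * (1 - Nov * θ₀ * cr)⁻¹ * cr) * Real.exp (-((δ - 2 * σ) * g.dist y y'))) :=
  hasMaj_idef_glueInv blk π htri hd hd0 hrow hσ hcr (mul_nonneg hNov hβ) (mul_nonneg hNov hθ) (mul_nonneg hNov (by positivity)) (mul_nonneg hNov (by positivity)) hσδ
    (hasMaj_parametrix (blk ∘ π) S hβ hh' hN hG') (hasMaj_remainder_in blk S hθ hh hN hK) (hasMaj_remainder_in (blk ∘ π) S hθ hh' hN hK')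
    (hasMaj_idef_parametrix blk π S hβ hm ho hh hh' hfit hN hG hG' hDG) (hasMaj_idef_remainder_in blk π S hθ hr ho hh hfit hN hK' hDK) hq

end Glued

end Summit.QuantumFields.YangMills.BalabanUVNodes.N15.Gluing

end
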